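import Summits.KontsevichZagierPeriods.Zeta5Search.Criteria
import HarnessLib

/-!
# ζ(5) search — denominators with geometric and bounded factors (cell `pub-zeta5`, TYPER)

HONEST FRAMING: systematic search; no irrationality claim unless certified.

`Criteria.lean` types the standard denominators `D n = ∏ᵢ lcm(1..cᵢ n)^{kᵢ}` (rate `∑ cᵢ kᵢ` by the
prime number theorem proved in the tree). Constructions for CATALAN's constant (criterion C3;
Zudilin 2003, Rivoal–Zudilin 2003) and several `ζ(5)` normalisations (Zudilin 2002:
`2 Dₙ⁵ pₙ ∈ ℤ`; Brown–Zudilin 2022 (6)–(7)) carry extra factors: a geometric one `g^n`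
(typically a power of `2`) and a bounded integer constant `C`. This file supplies the rates:

* `eventually_const_pow_prod_lcmUpto_le_exp` — for `C ≥ 1`, `g ≥ 1`, `ε > 0`:
  `C · g^n · ∏ᵢ lcm(1..cᵢ n)^{kᵢ} ≤ exp((log g + ∑ cᵢ kᵢ + ε) n)` for all large `n`;
* `irrational_of_pow_lcm_linear_forms` — criterion C1/C3 with `D n = C g^n ∏ᵢ d_{cᵢ n}^{kᵢ}`,
  savings `Φ n`, decay `c'`, and the margin `log g + ∑ cᵢ kᵢ < c' + φ'` (PNT discharged);
* `catalanIrrational_of_pow_lcm_linear_forms` — the same, concluding the tree's open statement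
  `CatalanIrrational` for `ξ = catalanConstant` (implication only; no forms are constructed).

Everything is PROVED; no definitions, no named facts.
-/

noncomputable section

open Filter Topology Finset
open Literature.NumberTheory.Transcendental

namespace Summit.KontsevichZagierPeriods.Zeta5Search

/-- **Rate of `C · g^n · ∏ᵢ lcm(1..cᵢ n)^{kᵢ}`.** For naturals `C, g ≥ 1`, `cᵢ, kᵢ` and `ε > 0`:
`C g^n ∏ᵢ lcm(1..cᵢ n)^{kᵢ} ≤ exp((log g + ∑ᵢ cᵢ kᵢ + ε) n)` for all large `n`
(`eventually_prod_lcmUpto_pow_le_exp` with `ε/2`, and `log C ≤ (ε/2) n` eventually). -/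
theorem eventually_const_pow_prod_lcmUpto_le_exp (C g : ℕ) (hC : 1 ≤ C) (hg : 1 ≤ g) {m : ℕ}
    (c k : Fin m → ℕ) {ε : ℝ} (hε : 0 < ε) :
    ∀ᶠ n : ℕ in atTop, ((C : ℝ) * (g : ℝ) ^ n * ∏ i, ((Nat.lcmUpto (c i * n) : ℝ)) ^ (k i)) ≤
      Real.exp ((Real.log g + (∑ i, ((c i * k i : ℕ) : ℝ)) + ε) * n) := by
  have hε2 : 0 < ε / 2 := by linarith
  have hC0 : (0 : ℝ) < C := by exact_mod_cast hC
  have hg0 : (0 : ℝ) < g := by exact_mod_cast hg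
  -- `log C ≤ (ε/2) n` for large `n`
  have hlogC : ∀ᶠ n : ℕ in atTop, Real.log C ≤ ε / 2 * n :=
    (tendsto_natCast_atTop_atTop.const_mul_atTop hε2).eventually_ge_atTop _
  filter_upwards [eventually_prod_lcmUpto_pow_le_exp c k hε2, hlogC] with n hprod hn
  have hP : (0 : ℝ) ≤ ∏ i, ((Nat.lcmUpto (c i * n) : ℝ)) ^ (k i) := by positivity
  have e : Real.exp ((Real.log g + (∑ i, ((c i * k i : ℕ) : ℝ)) + ε) * n) =
      Real.exp (ε / 2 * n) * Real.exp (Real.log g * n) *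
        Real.exp (((∑ i, ((c i * k i : ℕ) : ℝ)) + ε / 2) * n) := by
    rw [← Real.exp_add, ← Real.exp_add]; congr 1; ring
  rw [e]
  have h1 : (C : ℝ) ≤ Real.exp (ε / 2 * n) := by
    rw [← Real.exp_log hC0]; exact Real.exp_le_exp.2 hn
  have h2 : (g : ℝ) ^ n = Real.exp (Real.log g * n) := by
    rw [mul_comm, Real.exp_nat_mul, Real.exp_log hg0]
  rw [← h2]
  exact mul_le_mul (mul_le_mul_of_nonneg_right h1 (by positivity)) hprod hP (by positivity)

/-- Positivity of `C g^n ∏ᵢ lcm(1..cᵢ n)^{kᵢ}` for `C, g ≥ 1`. -/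
theorem const_pow_prod_lcmUpto_pos {C g : ℕ} (hC : 1 ≤ C) (hg : 1 ≤ g) {m : ℕ} (c k : Fin m → ℕ)
    (n : ℕ) : 0 < C * g ^ n * ∏ i, (Nat.lcmUpto (c i * n)) ^ (k i) :=
  Nat.mul_pos (Nat.mul_pos hC (pow_pos hg n)) (prod_lcmUpto_pow_pos c k n)

/-- **Criterion C1/C3 with denominators `C g^n ∏ᵢ d_{cᵢ n}^{kᵢ}` (PNT discharged).** Raw forms
`ℓ n` with `(C g^n ∏ᵢ d_{cᵢ n}^{kᵢ}) ℓ n = Φ n (a n + b n ξ)` for large `n` (`a n, b n ∈ ℤ`,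
`Φ n ∈ ℕ⁺`, `C, g ≥ 1`), decay `|ℓ n| ≤ e^{-c' n}`, savings `e^{φ' n} ≤ Φ n` for large `n`,
`ℓ n ≠ 0` infinitely often, and the margin `log g + ∑ᵢ cᵢ kᵢ < c' + φ'`: then `ξ ∉ ℚ`. -/
theorem irrational_of_pow_lcm_linear_forms {ξ : ℝ} (ℓ : ℕ → ℝ) (C g : ℕ) (hC : 1 ≤ C)
    (hg : 1 ≤ g) {m : ℕ} (c k : Fin m → ℕ) (Φ : ℕ → ℕ) (a b : ℕ → ℤ)
    (decayRate savingRate : ℝ) (hΦ : ∀ n, 0 < Φ n)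
    (harith : ∀ᶠ n : ℕ in atTop,
      ((C : ℝ) * (g : ℝ) ^ n * ∏ i, ((Nat.lcmUpto (c i * n) : ℝ)) ^ (k i)) * ℓ n =
        Φ n * (a n + b n * ξ))
    (hdecay : ∀ᶠ n : ℕ in atTop, |ℓ n| ≤ Real.exp (-(decayRate * n)))
    (hsaving : ∀ᶠ n : ℕ in atTop, Real.exp (savingRate * n) ≤ Φ n)
    (hne : ∃ᶠ n : ℕ in atTop, ℓ n ≠ 0)
    (hmargin : Real.log g + (∑ i, ((c i * k i : ℕ) : ℝ)) < decayRate + savingRate) :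
    Irrational ξ := by
  set ε : ℝ := (decayRate + savingRate - (Real.log g + ∑ i, ((c i * k i : ℕ) : ℝ))) / 2 with hε
  have hε0 : 0 < ε := by rw [hε]; linarith
  exact LinearFormCertificate.irrational (ξ := ξ)
    { form := ℓ
      denom := fun n => C * g ^ n * ∏ i, (Nat.lcmUpto (c i * n)) ^ (k i)
      saving := Φ
      coeffConst := a
      coeffXi := b
      decayRate := decayRate
      denomRate := Real.log g + (∑ i, ((c i * k i : ℕ) : ℝ)) + ε
      savingRate := savingRate
      denom_pos := const_pow_prod_lcmUpto_pos hC hg c k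
      saving_pos := hΦ
      arith := by
        filter_upwards [harith] with n hn
        push_cast
        exact hn
      decay := hdecay
      denom_le := by
        filter_upwards [eventually_const_pow_prod_lcmUpto_le_exp C g hC hg c k hε0] with n hn
        exact_mod_cast hn
      le_saving := hsaving
      nonvanishing := hne
      margin_pos := by rw [hε]; linarith }

/-- **Catalan's constant, C3 with `2`-power denominators.** Forms `ℓ n` in `(1, G)` with
`(C g^n ∏ᵢ d_{cᵢ n}^{kᵢ}) ℓ n = Φ n (a n + b n G)`, decay `c'`, savings `φ'`, non-vanishing, and
`log g + ∑ cᵢ kᵢ < c' + φ'` prove the tree's open statement `CatalanIrrational`. (Implication only: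
Zudilin 2003 / Rivoal–Zudilin 2003 give such forms with `g = 2^4`-type factors and NEGATIVE
margin.) -/
theorem catalanIrrational_of_pow_lcm_linear_forms (ℓ : ℕ → ℝ) (C g : ℕ) (hC : 1 ≤ C)
    (hg : 1 ≤ g) {m : ℕ} (c k : Fin m → ℕ) (Φ : ℕ → ℕ) (a b : ℕ → ℤ)
    (decayRate savingRate : ℝ) (hΦ : ∀ n, 0 < Φ n)
    (harith : ∀ᶠ n : ℕ in atTop,
      ((C : ℝ) * (g : ℝ) ^ n * ∏ i, ((Nat.lcmUpto (c i * n) : ℝ)) ^ (k i)) * ℓ n =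
        Φ n * (a n + b n * catalanConstant))
    (hdecay : ∀ᶠ n : ℕ in atTop, |ℓ n| ≤ Real.exp (-(decayRate * n)))
    (hsaving : ∀ᶠ n : ℕ in atTop, Real.exp (savingRate * n) ≤ Φ n)
    (hne : ∃ᶠ n : ℕ in atTop, ℓ n ≠ 0)
    (hmargin : Real.log g + (∑ i, ((c i * k i : ℕ) : ℝ)) < decayRate + savingRate) :
    CatalanIrrational :=
  irrational_of_pow_lcm_linear_forms ℓ C g hC hg c k Φ a b decayRate savingRate hΦ harith hdecay
    hsaving hne hmargin

end Summit.KontsevichZagierPeriods.Zeta5Search
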